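import Summits.BirchSwinnertonDyer.Rank1Residual.X9.TransportHasseWeil
import Summits.BirchSwinnertonDyer.Rank1Residual.X9.TransportHasseWeilRecordsD
import Summits.BirchSwinnertonDyer.Rank1Residual.X9.TransportPairsB
import Summits.BirchSwinnertonDyer.Rank1Residual.X9.TransportPairsC
import Summits.BirchSwinnertonDyer.Rank1Residual.X9.TransportPairsD
import HarnessLib

/-!
# Class X9, `p = 5`: congruence-transport records RE-KEYED on the Hasse–Weil twin of Kraus–Oesterlé Prop. 4 — part E (6 records; KO92 R-20 repair, step 2)

HONEST FRAMING (cell `b2b-bsdres-*`, verbatim): the cell deletes COMBINATION-SHAPED residual classes of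
the rank-≤1 BSD formula from PUBLISHED theorems only and TYPES the construction-shaped remainder; this
is not "finishing BSD". Class X9 (good ordinary `p ≥ 5`, `ρ̄_{E,p}` irreducible and not surjective) stays
TYPED at class level; everything here is PER PAIR (or generic); no lane verdict is changed; no named fact is
introduced; nothing is booked by this unit (the lane books, the referee rules). Unit `b2b-bsdres-x9`, gen 47.

## Why (the KO92 clause defect, ARM-P register R-20 `KO92-Prop4-(ii)b-frobeniusTrace-offset`, 2026-08-27)

The cited-facts audit (`pub/bsd-cited`, sheet `D-AUDIT-r07-Q41-KO92-LS18.md`) found that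
`KrausOesterle1992.prop4_torsionIso_of_congruences` types Prop. 4 (ii)'s clause "`ℓ ∣ NN'`, `ℓ² ∤ NN'` ⇒
`a_ℓ a'_ℓ ≡ ℓ + 1 (mod p)`" over the tree's `frobeniusTrace`, which at the multiplicative curve of such a pair is
`2` / `0` (`= 1 + a_ℓ`; `X11b.LocalTorsion.frobeniusTrace_eq_two_of_split` / `…_zero_of_nonsplit`), not the
Hasse–Weil `a_ℓ = ±1` the paper multiplies (Math. Ann. 293, p. 263 L8–9). Every X9 congruence-transport record displays
that list on a pair whose `N_E·N_A` has a simple prime far below `μ(M)/6` (x9 GEN 47 owner census: 35 / 35 EXPOSED),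
so each is VACUOUS AS TYPED, while its two-engine certificate (Hasse–Weil `a_ℓ`) stands. The typing layer lands the
corrected twin `KrausOesterle1992.prop4_torsionIso_of_congruences_hasseWeil` (target T-Q41-1; the `= 1 →` conjunct over
`W.LFunction ℓ * W'.LFunction ℓ`, Mathlib's `WeierstrassCurve.LFunction` having the Hasse–Weil `a_ℓ` as prime
coefficient at EVERY prime); the X9 lane re-keys its consumers on it: step 0 `X9/TransportTorsionIso.lean` (p494287,
consumers keyed on the isomorphism), step 1 `X9/TransportHasseWeil.lean` (generic), step 2 these record files.

## Records in this part (each = the original's statement with `hKO` := the twin and ONE token in `hcong`; proof = the original's, through the `_hasseWeil` generic layer; the originals stay in the tree byte-identical — their status as closed statements is ARM-P target T-Q41-2's, not this lane's)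

* `bsdp_t337977n1_of_bsdp_s19881h1_hasseWeil` ← `X9/TransportPairsB.lean`'s `bsdp_t337977n1_of_bsdp_s19881h1` (337977n1 ← 19881h1; exposing prime(s) 17)
* `bsdp_t337977p1_of_bsdp_s19881i1_hasseWeil` ← `X9/TransportPairsB.lean`'s `bsdp_t337977p1_of_bsdp_s19881i1` (337977p1 ← 19881i1; exposing prime(s) 17)
* `bsdp_t274428h1_of_bsdp_s39204h1_hasseWeil` ← `X9/TransportPairsC.lean`'s `bsdp_t274428h1_of_bsdp_s39204h1` (274428h1 ← 39204h1; exposing prime(s) 7)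
* `bsdp_t168948a1_of_bsdp_s12996j1_hasseWeil` ← `X9/TransportPairsC.lean`'s `bsdp_t168948a1_of_bsdp_s12996j1` (168948a1 ← 12996j1; exposing prime(s) 13)
* `bsdp_t206388x1_of_bsdp_s15876i1_hasseWeil` ← `X9/TransportPairsC.lean`'s `bsdp_t206388x1_of_bsdp_s15876i1` (206388x1 ← 15876i1; exposing prime(s) 13)
* `bsdp_t199988e1_hasseWeil'` ← `X9/TransportPairsD.lean`'s `bsdp_t199988e1'` (199988e1 ← 8092e1; exposing prime(s) 7, 173)

No certificate is recomputed: the engines (PARI `ellap`; ENGINE D) computed Hasse–Weil `a_ℓ` — print's clause — in the kits named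
in each docstring. References: as in the original files; Kraus–Oesterlé, Math. Ann. 293 (1992) Prop. 4 (ii), pp. 263–264.
-/

set_option autoImplicit false

noncomputable section

open scoped Classical MatrixGroups ModularForm

open CongruenceSubgroup WeierstrassCurve Literature.NumberTheory.EllipticCurves
  Literature.NumberTheory.EllipticCurves.ModularForms Literature.NumberTheory.EllipticCurves.Rank1Residual
  Literature.NumberTheory.EllipticCurves.Rank1Residual.Typed
  Literature.NumberTheory.EllipticCurves.Rank1Residual.X11RankOneCertificates
  Summit.BirchSwinnertonDyer.BirchSwinnertonDyer.Rank1Residual.IntModel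
  Summit.BirchSwinnertonDyer.BirchSwinnertonDyer.Rank1Residual.X11RankOne
  Summit.BirchSwinnertonDyer.Rank1Residual.X11b

namespace Summit.BirchSwinnertonDyer.Rank1Residual.X9

/-! ### The re-keyed records -/

/-- **`BSD(E,5)`-side record for `337977n1` from `19881h1`, RE-KEYED on the Hasse–Weil twin of Kraus–Oesterlé Prop. 4** (ARM-P register
R-20 `KO92-Prop4-(ii)b-frobeniusTrace-offset`; x9 GEN 47 census `HOME/b2b-bsdres-x9/g47/KO92-EXPOSURE-X9.md`): the record
`bsdp_t337977n1_of_bsdp_s19881h1` of `X9/TransportPairsB.lean` — same Cremona models, same kernel-decided data (its `card_*` / `isElliptic_*` /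
`isGloballyMinimal_*` theorems are imported, not re-proved), same PUBLISHED and FINITE binders (see that docstring for every number) —
with (i) `hKO` := the corrected statement `KrausOesterle1992.prop4_torsionIso_of_congruences_hasseWeil` and (ii) the `v_ℓ(N_E N_A) = 1`
conjunct of the displayed list `hcong` over `W.LFunction ℓ * A.LFunction ℓ` — Mathlib's `WeierstrassCurve.LFunction`, whose prime
coefficient is the HASSE–WEIL `a_ℓ`, `= ±1` at the multiplicative curve (Kraus–Oesterlé, Math. Ann. 293, p. 263 L8–9) — instead of the
tree's `frobeniusTrace` (`= 2 / 0` there, `X11b.LocalTorsion.frobeniusTrace_eq_two_of_split` / `…_zero_of_nonsplit`), which made the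
original's `hcong` unsatisfiable at the simple prime(s) ℓ ∈ {17} of `N_E·N_A` and the original VACUOUS AS TYPED. Hasse–Weil `a_ℓ` is the
currency in which the two engines (PARI `ellap`; ENGINE D pure-Python BSGS/Mestre; kit j127638) CERTIFIED the list: no certificate changes.
Per pair; nothing booked; X9 stays typed. [cite: KrausOesterle1992, Prop. 4 (ii), pp. 263–264] [cite: GreenbergVatsal2000, Thm. (1.4) (arXiv p. 5)]
[cite: Cremona2006, Table 1 (Cremona labels 337977n1, 19881h1)] -/
theorem bsdp_t337977n1_of_bsdp_s19881h1_hasseWeil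
    (hKO : KrausOesterle1992.prop4_torsionIso_of_congruences_hasseWeil)
    (hBCS : burungale_castella_skinner_charIdeal_eq_padicLFunction)
    (hGr : greenberg_charValue_rankZero) (h5 : realPeriodRat_eq_unit_mul_plusPeriod)
    (hGV : GreenbergVatsal2000.thm14_mainConjecture_transfer_of_torsionIso)
    (hS : Schneider1985_order_charGenerator) (hPR : perrinRiou_rankOne_leadingTerms)
    (hmodP : nonempty_modularParametrizationData) (hmodL : hasEntireLFunction_rat)
    (hGZK : rank_eq_analyticRank_of_analyticRank_le_one)
    (W A : WeierstrassCurve ℚ) [W.IsElliptic] [W.IsGloballyMinimal] [A.IsElliptic] [A.IsGloballyMinimal]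
    [Fact (Nat.Prime 5)]
    (hW : W = ⟨0, 0, 1, 172302, 45642910⟩) (hA : A = ⟨0, 0, 1, -622938, -213486044⟩)
    (hr : W.analyticRank = 0) (hrA : A.analyticRank ≤ 1) (hbsdA : BSDp A 5)
    (hSchA : A.analyticRank = 1 → ∀ Dh : PAdicHeightData A 5, Dh.IsCanonical → SchneiderConjecture Dh)
    (hcertA : ∀ [NeZero (A.conductorNorm ℤ)] (fA : CuspForm (Gamma0 (A.conductorNorm ℤ)) 2),
        IsNewformOf A fA → ∀ (ϖ : ℚ), (ϖ : ℝ) * A.realPeriodRat = plusPeriod fA →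
      ∃ n : ℕ, ‖PowerSeries.coeff n
        (PowerSeries.C (ϖ : ℚ_[5]) * padicLFunction fA (unitRoot A 5 : ℚ_[5]))‖ = 1)
    (hcong : ∀ (ℓ : ℕ) [Fact ℓ.Prime],
      6 * ℓ < KrausOesterle1992.gammaZeroIndex (KrausOesterle1992.modulus W A) →
      (padicValNat ℓ (W.conductorNorm ℤ * A.conductorNorm ℤ) = 0 →
          (5 : ℤ) ∣ W.frobeniusTrace ℓ - A.frobeniusTrace ℓ) ∧
        (padicValNat ℓ (W.conductorNorm ℤ * A.conductorNorm ℤ) = 1 →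
          (5 : ℤ) ∣ W.LFunction ℓ * A.LFunction ℓ - (ℓ + 1))) :
    BSDp W 5 := by
  have hIW : integralModelInt W = ⟨0, 0, 1, 172302, 45642910⟩ :=
    integralModelInt_eq_of_map_eq _ (by rw [hW]; ext <;> simp [WeierstrassCurve.map])
  have hIA : integralModelInt A = ⟨0, 0, 1, -622938, -213486044⟩ :=
    integralModelInt_eq_of_map_eq _ (by rw [hA]; ext <;> simp [WeierstrassCurve.map])
  haveI : Fact (Nat.Prime 7) := ⟨by norm_num⟩
  exact bsdp_of_ainvs_of_bsdpPartner_of_congruences_hasseWeil hKO hBCS hGr h5 hGV hS hPR hmodP hmodL hGZK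
    0 0 1 172302 45642910 hIW
    0 0 1 (-622938) (-213486044) hIA
    5 7 8 7 2 (by norm_num) (by decide +kernel) card_t337977n1_5 (by decide) (by decide)
    (by decide +kernel) card_t337977n1_7 (by decide) (by decide +kernel) card_s19881h1_5 (by decide)
    hr hrA hbsdA hSchA hcertA hcong

/-- **`BSD(E,5)`-side record for `337977p1` from `19881i1`, RE-KEYED on the Hasse–Weil twin of Kraus–Oesterlé Prop. 4** (ARM-P register
R-20 `KO92-Prop4-(ii)b-frobeniusTrace-offset`; x9 GEN 47 census `HOME/b2b-bsdres-x9/g47/KO92-EXPOSURE-X9.md`): the record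
`bsdp_t337977p1_of_bsdp_s19881i1` of `X9/TransportPairsB.lean` — same Cremona models, same kernel-decided data (its `card_*` / `isElliptic_*` /
`isGloballyMinimal_*` theorems are imported, not re-proved), same PUBLISHED and FINITE binders (see that docstring for every number) —
with (i) `hKO` := the corrected statement `KrausOesterle1992.prop4_torsionIso_of_congruences_hasseWeil` and (ii) the `v_ℓ(N_E N_A) = 1`
conjunct of the displayed list `hcong` over `W.LFunction ℓ * A.LFunction ℓ` — Mathlib's `WeierstrassCurve.LFunction`, whose prime
coefficient is the HASSE–WEIL `a_ℓ`, `= ±1` at the multiplicative curve (Kraus–Oesterlé, Math. Ann. 293, p. 263 L8–9) — instead of the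
tree's `frobeniusTrace` (`= 2 / 0` there, `X11b.LocalTorsion.frobeniusTrace_eq_two_of_split` / `…_zero_of_nonsplit`), which made the
original's `hcong` unsatisfiable at the simple prime(s) ℓ ∈ {17} of `N_E·N_A` and the original VACUOUS AS TYPED. Hasse–Weil `a_ℓ` is the
currency in which the two engines (PARI `ellap`; ENGINE D pure-Python BSGS/Mestre; kit j127638) CERTIFIED the list: no certificate changes.
Per pair; nothing booked; X9 stays typed. [cite: KrausOesterle1992, Prop. 4 (ii), pp. 263–264] [cite: GreenbergVatsal2000, Thm. (1.4) (arXiv p. 5)]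
[cite: Cremona2006, Table 1 (Cremona labels 337977p1, 19881i1)] -/
theorem bsdp_t337977p1_of_bsdp_s19881i1_hasseWeil
    (hKO : KrausOesterle1992.prop4_torsionIso_of_congruences_hasseWeil)
    (hBCS : burungale_castella_skinner_charIdeal_eq_padicLFunction)
    (hGr : greenberg_charValue_rankZero) (h5 : realPeriodRat_eq_unit_mul_plusPeriod)
    (hGV : GreenbergVatsal2000.thm14_mainConjecture_transfer_of_torsionIso)
    (hS : Schneider1985_order_charGenerator) (hPR : perrinRiou_rankOne_leadingTerms)
    (hmodP : nonempty_modularParametrizationData) (hmodL : hasEntireLFunction_rat)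
    (hGZK : rank_eq_analyticRank_of_analyticRank_le_one)
    (W A : WeierstrassCurve ℚ) [W.IsElliptic] [W.IsGloballyMinimal] [A.IsElliptic] [A.IsGloballyMinimal]
    [Fact (Nat.Prime 5)]
    (hW : W = ⟨0, 0, 1, 380615118, -4738783870886⟩) (hA : A = ⟨0, 0, 1, -282, 2056⟩)
    (hr : W.analyticRank = 0) (hrA : A.analyticRank ≤ 1) (hbsdA : BSDp A 5)
    (hSchA : A.analyticRank = 1 → ∀ Dh : PAdicHeightData A 5, Dh.IsCanonical → SchneiderConjecture Dh)
    (hcertA : ∀ [NeZero (A.conductorNorm ℤ)] (fA : CuspForm (Gamma0 (A.conductorNorm ℤ)) 2),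
        IsNewformOf A fA → ∀ (ϖ : ℚ), (ϖ : ℝ) * A.realPeriodRat = plusPeriod fA →
      ∃ n : ℕ, ‖PowerSeries.coeff n
        (PowerSeries.C (ϖ : ℚ_[5]) * padicLFunction fA (unitRoot A 5 : ℚ_[5]))‖ = 1)
    (hcong : ∀ (ℓ : ℕ) [Fact ℓ.Prime],
      6 * ℓ < KrausOesterle1992.gammaZeroIndex (KrausOesterle1992.modulus W A) →
      (padicValNat ℓ (W.conductorNorm ℤ * A.conductorNorm ℤ) = 0 →
          (5 : ℤ) ∣ W.frobeniusTrace ℓ - A.frobeniusTrace ℓ) ∧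
        (padicValNat ℓ (W.conductorNorm ℤ * A.conductorNorm ℤ) = 1 →
          (5 : ℤ) ∣ W.LFunction ℓ * A.LFunction ℓ - (ℓ + 1))) :
    BSDp W 5 := by
  have hIW : integralModelInt W = ⟨0, 0, 1, 380615118, -4738783870886⟩ :=
    integralModelInt_eq_of_map_eq _ (by rw [hW]; ext <;> simp [WeierstrassCurve.map])
  have hIA : integralModelInt A = ⟨0, 0, 1, -282, 2056⟩ :=
    integralModelInt_eq_of_map_eq _ (by rw [hA]; ext <;> simp [WeierstrassCurve.map])
  haveI : Fact (Nat.Prime 7) := ⟨by norm_num⟩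
  exact bsdp_of_ainvs_of_bsdpPartner_of_congruences_hasseWeil hKO hBCS hGr h5 hGV hS hPR hmodP hmodL hGZK
    0 0 1 380615118 (-4738783870886) hIW
    0 0 1 (-282) 2056 hIA
    5 7 8 5 10 (by norm_num) (by decide +kernel) card_t337977p1_5 (by decide) (by decide)
    (by decide +kernel) card_t337977p1_7 (by decide) (by decide +kernel) card_s19881i1_5 (by decide)
    hr hrA hbsdA hSchA hcertA hcong

/-- **`BSD(E,5)`-side record for `274428h1` from `39204h1`, RE-KEYED on the Hasse–Weil twin of Kraus–Oesterlé Prop. 4** (ARM-P register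
R-20 `KO92-Prop4-(ii)b-frobeniusTrace-offset`; x9 GEN 47 census `HOME/b2b-bsdres-x9/g47/KO92-EXPOSURE-X9.md`): the record
`bsdp_t274428h1_of_bsdp_s39204h1` of `X9/TransportPairsC.lean` — same Cremona models, same kernel-decided data (its `card_*` / `isElliptic_*` /
`isGloballyMinimal_*` theorems are imported, not re-proved), same PUBLISHED and FINITE binders (see that docstring for every number) —
with (i) `hKO` := the corrected statement `KrausOesterle1992.prop4_torsionIso_of_congruences_hasseWeil` and (ii) the `v_ℓ(N_E N_A) = 1`
conjunct of the displayed list `hcong` over `W.LFunction ℓ * A.LFunction ℓ` — Mathlib's `WeierstrassCurve.LFunction`, whose prime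
coefficient is the HASSE–WEIL `a_ℓ`, `= ±1` at the multiplicative curve (Kraus–Oesterlé, Math. Ann. 293, p. 263 L8–9) — instead of the
tree's `frobeniusTrace` (`= 2 / 0` there, `X11b.LocalTorsion.frobeniusTrace_eq_two_of_split` / `…_zero_of_nonsplit`), which made the
original's `hcong` unsatisfiable at the simple prime(s) ℓ ∈ {7} of `N_E·N_A` and the original VACUOUS AS TYPED. Hasse–Weil `a_ℓ` is the
currency in which the two engines (PARI `ellap`; ENGINE D pure-Python BSGS/Mestre; kit j127638) CERTIFIED the list: no certificate changes.
Per pair; nothing booked; X9 stays typed. [cite: KrausOesterle1992, Prop. 4 (ii), pp. 263–264] [cite: GreenbergVatsal2000, Thm. (1.4) (arXiv p. 5)]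
[cite: Cremona2006, Table 1 (Cremona labels 274428h1, 39204h1)] -/
theorem bsdp_t274428h1_of_bsdp_s39204h1_hasseWeil
    (hKO : KrausOesterle1992.prop4_torsionIso_of_congruences_hasseWeil)
    (hBCS : burungale_castella_skinner_charIdeal_eq_padicLFunction)
    (hGr : greenberg_charValue_rankZero) (h5 : realPeriodRat_eq_unit_mul_plusPeriod)
    (hGV : GreenbergVatsal2000.thm14_mainConjecture_transfer_of_torsionIso)
    (hS : Schneider1985_order_charGenerator) (hPR : perrinRiou_rankOne_leadingTerms)
    (hmodP : nonempty_modularParametrizationData) (hmodL : hasEntireLFunction_rat)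
    (hGZK : rank_eq_analyticRank_of_analyticRank_le_one)
    (W A : WeierstrassCurve ℚ) [W.IsElliptic] [W.IsGloballyMinimal] [A.IsElliptic] [A.IsGloballyMinimal]
    [Fact (Nat.Prime 5)]
    (hW : W = ⟨0, 0, 0, -140481, -21813759⟩) (hA : A = ⟨0, 0, 0, 1089, 23958⟩)
    (hr : W.analyticRank = 0) (hrA : A.analyticRank ≤ 1) (hbsdA : BSDp A 5)
    (hSchA : A.analyticRank = 1 → ∀ Dh : PAdicHeightData A 5, Dh.IsCanonical → SchneiderConjecture Dh)
    (hcertA : ∀ [NeZero (A.conductorNorm ℤ)] (fA : CuspForm (Gamma0 (A.conductorNorm ℤ)) 2),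
        IsNewformOf A fA → ∀ (ϖ : ℚ), (ϖ : ℝ) * A.realPeriodRat = plusPeriod fA →
      ∃ n : ℕ, ‖PowerSeries.coeff n
        (PowerSeries.C (ϖ : ℚ_[5]) * padicLFunction fA (unitRoot A 5 : ℚ_[5]))‖ = 1)
    (hcong : ∀ (ℓ : ℕ) [Fact ℓ.Prime],
      6 * ℓ < KrausOesterle1992.gammaZeroIndex (KrausOesterle1992.modulus W A) →
      (padicValNat ℓ (W.conductorNorm ℤ * A.conductorNorm ℤ) = 0 →
          (5 : ℤ) ∣ W.frobeniusTrace ℓ - A.frobeniusTrace ℓ) ∧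
        (padicValNat ℓ (W.conductorNorm ℤ * A.conductorNorm ℤ) = 1 →
          (5 : ℤ) ∣ W.LFunction ℓ * A.LFunction ℓ - (ℓ + 1))) :
    BSDp W 5 := by
  have hIW : integralModelInt W = ⟨0, 0, 0, -140481, -21813759⟩ :=
    integralModelInt_eq_of_map_eq _ (by rw [hW]; ext <;> simp [WeierstrassCurve.map])
  have hIA : integralModelInt A = ⟨0, 0, 0, 1089, 23958⟩ :=
    integralModelInt_eq_of_map_eq _ (by rw [hA]; ext <;> simp [WeierstrassCurve.map])
  haveI : Fact (Nat.Prime 13) := ⟨by norm_num⟩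
  exact bsdp_of_ainvs_of_bsdpPartner_of_congruences_hasseWeil hKO hBCS hGr h5 hGV hS hPR hmodP hmodL hGZK
    0 0 0 (-140481) (-21813759) hIW
    0 0 0 1089 23958 hIA
    5 13 14 8 3 (by norm_num) (by decide +kernel) card_t274428h1_5 (by decide) (by decide)
    (by decide +kernel) card_t274428h1_13 (by decide) (by decide +kernel) card_s39204h1_5 (by decide)
    hr hrA hbsdA hSchA hcertA hcong

/-- **`BSD(E,5)`-side record for `168948a1` from `12996j1`, RE-KEYED on the Hasse–Weil twin of Kraus–Oesterlé Prop. 4** (ARM-P register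
R-20 `KO92-Prop4-(ii)b-frobeniusTrace-offset`; x9 GEN 47 census `HOME/b2b-bsdres-x9/g47/KO92-EXPOSURE-X9.md`): the record
`bsdp_t168948a1_of_bsdp_s12996j1` of `X9/TransportPairsC.lean` — same Cremona models, same kernel-decided data (its `card_*` / `isElliptic_*` /
`isGloballyMinimal_*` theorems are imported, not re-proved), same PUBLISHED and FINITE binders (see that docstring for every number) —
with (i) `hKO` := the corrected statement `KrausOesterle1992.prop4_torsionIso_of_congruences_hasseWeil` and (ii) the `v_ℓ(N_E N_A) = 1`
conjunct of the displayed list `hcong` over `W.LFunction ℓ * A.LFunction ℓ` — Mathlib's `WeierstrassCurve.LFunction`, whose prime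
coefficient is the HASSE–WEIL `a_ℓ`, `= ±1` at the multiplicative curve (Kraus–Oesterlé, Math. Ann. 293, p. 263 L8–9) — instead of the
tree's `frobeniusTrace` (`= 2 / 0` there, `X11b.LocalTorsion.frobeniusTrace_eq_two_of_split` / `…_zero_of_nonsplit`), which made the
original's `hcong` unsatisfiable at the simple prime(s) ℓ ∈ {13} of `N_E·N_A` and the original VACUOUS AS TYPED. Hasse–Weil `a_ℓ` is the
currency in which the two engines (PARI `ellap`; ENGINE D pure-Python BSGS/Mestre; kit j127638) CERTIFIED the list: no certificate changes.
Per pair; nothing booked; X9 stays typed. [cite: KrausOesterle1992, Prop. 4 (ii), pp. 263–264] [cite: GreenbergVatsal2000, Thm. (1.4) (arXiv p. 5)]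
[cite: Cremona2006, Table 1 (Cremona labels 168948a1, 12996j1)] -/
theorem bsdp_t168948a1_of_bsdp_s12996j1_hasseWeil
    (hKO : KrausOesterle1992.prop4_torsionIso_of_congruences_hasseWeil)
    (hBCS : burungale_castella_skinner_charIdeal_eq_padicLFunction)
    (hGr : greenberg_charValue_rankZero) (h5 : realPeriodRat_eq_unit_mul_plusPeriod)
    (hGV : GreenbergVatsal2000.thm14_mainConjecture_transfer_of_torsionIso)
    (hS : Schneider1985_order_charGenerator) (hPR : perrinRiou_rankOne_leadingTerms)
    (hmodP : nonempty_modularParametrizationData) (hmodL : hasEntireLFunction_rat)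
    (hGZK : rank_eq_analyticRank_of_analyticRank_le_one)
    (W A : WeierstrassCurve ℚ) [W.IsElliptic] [W.IsGloballyMinimal] [A.IsElliptic] [A.IsGloballyMinimal]
    [Fact (Nat.Prime 5)]
    (hW : W = ⟨0, 0, 0, -64838127, -448597462250⟩) (hA : A = ⟨0, 0, 0, -20577, -912247⟩)
    (hr : W.analyticRank = 0) (hrA : A.analyticRank ≤ 1) (hbsdA : BSDp A 5)
    (hSchA : A.analyticRank = 1 → ∀ Dh : PAdicHeightData A 5, Dh.IsCanonical → SchneiderConjecture Dh)
    (hcertA : ∀ [NeZero (A.conductorNorm ℤ)] (fA : CuspForm (Gamma0 (A.conductorNorm ℤ)) 2),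
        IsNewformOf A fA → ∀ (ϖ : ℚ), (ϖ : ℝ) * A.realPeriodRat = plusPeriod fA →
      ∃ n : ℕ, ‖PowerSeries.coeff n
        (PowerSeries.C (ϖ : ℚ_[5]) * padicLFunction fA (unitRoot A 5 : ℚ_[5]))‖ = 1)
    (hcong : ∀ (ℓ : ℕ) [Fact ℓ.Prime],
      6 * ℓ < KrausOesterle1992.gammaZeroIndex (KrausOesterle1992.modulus W A) →
      (padicValNat ℓ (W.conductorNorm ℤ * A.conductorNorm ℤ) = 0 →
          (5 : ℤ) ∣ W.frobeniusTrace ℓ - A.frobeniusTrace ℓ) ∧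
        (padicValNat ℓ (W.conductorNorm ℤ * A.conductorNorm ℤ) = 1 →
          (5 : ℤ) ∣ W.LFunction ℓ * A.LFunction ℓ - (ℓ + 1))) :
    BSDp W 5 := by
  have hIW : integralModelInt W = ⟨0, 0, 0, -64838127, -448597462250⟩ :=
    integralModelInt_eq_of_map_eq _ (by rw [hW]; ext <;> simp [WeierstrassCurve.map])
  have hIA : integralModelInt A = ⟨0, 0, 0, -20577, -912247⟩ :=
    integralModelInt_eq_of_map_eq _ (by rw [hA]; ext <;> simp [WeierstrassCurve.map])
  haveI : Fact (Nat.Prime 7) := ⟨by norm_num⟩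
  exact bsdp_of_ainvs_of_bsdpPartner_of_congruences_hasseWeil hKO hBCS hGr h5 hGV hS hPR hmodP hmodL hGZK
    0 0 0 (-64838127) (-448597462250) hIW
    0 0 0 (-20577) (-912247) hIA
    5 7 8 10 5 (by norm_num) (by decide +kernel) card_t168948a1_5 (by decide) (by decide)
    (by decide +kernel) card_t168948a1_7 (by decide) (by decide +kernel) card_s12996j1_5 (by decide)
    hr hrA hbsdA hSchA hcertA hcong

/-- **`BSD(E,5)`-side record for `206388x1` from `15876i1`, RE-KEYED on the Hasse–Weil twin of Kraus–Oesterlé Prop. 4** (ARM-P register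
R-20 `KO92-Prop4-(ii)b-frobeniusTrace-offset`; x9 GEN 47 census `HOME/b2b-bsdres-x9/g47/KO92-EXPOSURE-X9.md`): the record
`bsdp_t206388x1_of_bsdp_s15876i1` of `X9/TransportPairsC.lean` — same Cremona models, same kernel-decided data (its `card_*` / `isElliptic_*` /
`isGloballyMinimal_*` theorems are imported, not re-proved), same PUBLISHED and FINITE binders (see that docstring for every number) —
with (i) `hKO` := the corrected statement `KrausOesterle1992.prop4_torsionIso_of_congruences_hasseWeil` and (ii) the `v_ℓ(N_E N_A) = 1`
conjunct of the displayed list `hcong` over `W.LFunction ℓ * A.LFunction ℓ` — Mathlib's `WeierstrassCurve.LFunction`, whose prime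
coefficient is the HASSE–WEIL `a_ℓ`, `= ±1` at the multiplicative curve (Kraus–Oesterlé, Math. Ann. 293, p. 263 L8–9) — instead of the
tree's `frobeniusTrace` (`= 2 / 0` there, `X11b.LocalTorsion.frobeniusTrace_eq_two_of_split` / `…_zero_of_nonsplit`), which made the
original's `hcong` unsatisfiable at the simple prime(s) ℓ ∈ {13} of `N_E·N_A` and the original VACUOUS AS TYPED. Hasse–Weil `a_ℓ` is the
currency in which the two engines (PARI `ellap`; ENGINE D pure-Python BSGS/Mestre; kit j127638) CERTIFIED the list: no certificate changes.
Per pair; nothing booked; X9 stays typed. [cite: KrausOesterle1992, Prop. 4 (ii), pp. 263–264] [cite: GreenbergVatsal2000, Thm. (1.4) (arXiv p. 5)]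
[cite: Cremona2006, Table 1 (Cremona labels 206388x1, 15876i1)] -/
theorem bsdp_t206388x1_of_bsdp_s15876i1_hasseWeil
    (hKO : KrausOesterle1992.prop4_torsionIso_of_congruences_hasseWeil)
    (hBCS : burungale_castella_skinner_charIdeal_eq_padicLFunction)
    (hGr : greenberg_charValue_rankZero) (h5 : realPeriodRat_eq_unit_mul_plusPeriod)
    (hGV : GreenbergVatsal2000.thm14_mainConjecture_transfer_of_torsionIso)
    (hS : Schneider1985_order_charGenerator) (hPR : perrinRiou_rankOne_leadingTerms)
    (hmodP : nonempty_modularParametrizationData) (hmodL : hasEntireLFunction_rat)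
    (hGZK : rank_eq_analyticRank_of_analyticRank_le_one)
    (W A : WeierstrassCurve ℚ) [W.IsElliptic] [W.IsGloballyMinimal] [A.IsElliptic] [A.IsGloballyMinimal]
    [Fact (Nat.Prime 5)]
    (hW : W = ⟨0, 0, 0, -15150996, -22699887147⟩) (hA : A = ⟨0, 0, 0, -9261, 453789⟩)
    (hr : W.analyticRank = 0) (hrA : A.analyticRank ≤ 1) (hbsdA : BSDp A 5)
    (hSchA : A.analyticRank = 1 → ∀ Dh : PAdicHeightData A 5, Dh.IsCanonical → SchneiderConjecture Dh)
    (hcertA : ∀ [NeZero (A.conductorNorm ℤ)] (fA : CuspForm (Gamma0 (A.conductorNorm ℤ)) 2),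
        IsNewformOf A fA → ∀ (ϖ : ℚ), (ϖ : ℝ) * A.realPeriodRat = plusPeriod fA →
      ∃ n : ℕ, ‖PowerSeries.coeff n
        (PowerSeries.C (ϖ : ℚ_[5]) * padicLFunction fA (unitRoot A 5 : ℚ_[5]))‖ = 1)
    (hcong : ∀ (ℓ : ℕ) [Fact ℓ.Prime],
      6 * ℓ < KrausOesterle1992.gammaZeroIndex (KrausOesterle1992.modulus W A) →
      (padicValNat ℓ (W.conductorNorm ℤ * A.conductorNorm ℤ) = 0 →
          (5 : ℤ) ∣ W.frobeniusTrace ℓ - A.frobeniusTrace ℓ) ∧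
        (padicValNat ℓ (W.conductorNorm ℤ * A.conductorNorm ℤ) = 1 →
          (5 : ℤ) ∣ W.LFunction ℓ * A.LFunction ℓ - (ℓ + 1))) :
    BSDp W 5 := by
  have hIW : integralModelInt W = ⟨0, 0, 0, -15150996, -22699887147⟩ :=
    integralModelInt_eq_of_map_eq _ (by rw [hW]; ext <;> simp [WeierstrassCurve.map])
  have hIA : integralModelInt A = ⟨0, 0, 0, -9261, 453789⟩ :=
    integralModelInt_eq_of_map_eq _ (by rw [hA]; ext <;> simp [WeierstrassCurve.map])
  haveI : Fact (Nat.Prime 11) := ⟨by norm_num⟩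
  exact bsdp_of_ainvs_of_bsdpPartner_of_congruences_hasseWeil hKO hBCS hGr h5 hGV hS hPR hmodP hmodL hGZK
    0 0 0 (-15150996) (-22699887147) hIW
    0 0 0 (-9261) 453789 hIA
    5 11 8 3 8 (by norm_num) (by decide +kernel) card_t206388x1_5 (by decide) (by decide)
    (by decide +kernel) card_t206388x1_11 (by decide) (by decide +kernel) card_s15876i1_5 (by decide)
    hr hrA hbsdA hSchA hcertA hcong

/-- **`BSD(E,5)`-side record for `199988e1` from `8092e1`, RE-KEYED on the Hasse–Weil twin of Kraus–Oesterlé Prop. 4** (ARM-P register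
R-20 `KO92-Prop4-(ii)b-frobeniusTrace-offset`; x9 GEN 47 census `HOME/b2b-bsdres-x9/g47/KO92-EXPOSURE-X9.md`): the record
`bsdp_t199988e1'` of `X9/TransportPairsD.lean` — same Cremona models, same kernel-decided data (its `card_*` / `isElliptic_*` /
`isGloballyMinimal_*` theorems are imported, not re-proved), same PUBLISHED and FINITE binders (see that docstring for every number) —
with (i) `hKO` := the corrected statement `KrausOesterle1992.prop4_torsionIso_of_congruences_hasseWeil` and (ii) the `v_ℓ(N_E N_A) = 1`
conjunct of the displayed list `hcong` over `W.LFunction ℓ * A.LFunction ℓ` — Mathlib's `WeierstrassCurve.LFunction`, whose prime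
coefficient is the HASSE–WEIL `a_ℓ`, `= ±1` at the multiplicative curve (Kraus–Oesterlé, Math. Ann. 293, p. 263 L8–9) — instead of the
tree's `frobeniusTrace` (`= 2 / 0` there, `X11b.LocalTorsion.frobeniusTrace_eq_two_of_split` / `…_zero_of_nonsplit`), which made the
original's `hcong` unsatisfiable at the simple prime(s) ℓ ∈ {7, 173} of `N_E·N_A` and the original VACUOUS AS TYPED. Hasse–Weil `a_ℓ` is the
currency in which the two engines (PARI `ellap`; ENGINE D pure-Python BSGS/Mestre; kit j127638) CERTIFIED the list: no certificate changes.
Per pair; nothing booked; X9 stays typed. [cite: KrausOesterle1992, Prop. 4 (ii), pp. 263–264] [cite: GreenbergVatsal2000, Thm. (1.4) (arXiv p. 5)]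
[cite: Cremona2006, Table 1 (Cremona labels 199988e1, 8092e1)] -/
theorem bsdp_t199988e1_hasseWeil'
    (hKO : KrausOesterle1992.prop4_torsionIso_of_congruences_hasseWeil)
    (hBCS : burungale_castella_skinner_charIdeal_eq_padicLFunction)
    (hGr : greenberg_charValue_rankZero) (h5 : realPeriodRat_eq_unit_mul_plusPeriod)
    (hGV : GreenbergVatsal2000.thm14_mainConjecture_transfer_of_torsionIso)
    (hS : Schneider1985_order_charGenerator) (hPR : perrinRiou_rankOne_leadingTerms)
    (hmodP : nonempty_modularParametrizationData) (hmodL : hasEntireLFunction_rat)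
    (hGZK : rank_eq_analyticRank_of_analyticRank_le_one)
    (W A : WeierstrassCurve ℚ) [W.IsElliptic] [W.IsGloballyMinimal] [A.IsElliptic] [A.IsGloballyMinimal]
    [Fact (Nat.Prime 5)]
    (hW : W = ⟨0, 0, 0, -41642588, -103238220075⟩) (hA : A = ⟨0, 0, 0, -4913, 2088025⟩)
    (hr : W.analyticRank = 0) (hrA : A.analyticRank ≤ 1)
    {qA : ℚ} (hqA : shaAn A = (qA : ℂ)) (hvA : padicValRat 5 qA = 0)
    (hSelA : Nat.card (A.selmerGroup (5 : ℤ)) = 5 ^ A.analyticRank)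
    (hSchA : A.analyticRank = 1 → ∀ Dh : PAdicHeightData A 5, Dh.IsCanonical → SchneiderConjecture Dh)
    (hcertA : ∀ [NeZero (A.conductorNorm ℤ)] (fA : CuspForm (Gamma0 (A.conductorNorm ℤ)) 2),
        IsNewformOf A fA → ∀ (ϖ : ℚ), (ϖ : ℝ) * A.realPeriodRat = plusPeriod fA →
      ∃ n : ℕ, ‖PowerSeries.coeff n
        (PowerSeries.C (ϖ : ℚ_[5]) * padicLFunction fA (unitRoot A 5 : ℚ_[5]))‖ = 1)
    (hcong : ∀ (ℓ : ℕ) [Fact ℓ.Prime],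
      6 * ℓ < KrausOesterle1992.gammaZeroIndex (KrausOesterle1992.modulus W A) →
      (padicValNat ℓ (W.conductorNorm ℤ * A.conductorNorm ℤ) = 0 →
          (5 : ℤ) ∣ W.frobeniusTrace ℓ - A.frobeniusTrace ℓ) ∧
        (padicValNat ℓ (W.conductorNorm ℤ * A.conductorNorm ℤ) = 1 →
          (5 : ℤ) ∣ W.LFunction ℓ * A.LFunction ℓ - (ℓ + 1))) :
    BSDp W 5 :=
  bsdp_t199988e1_of_bsdp_s8092e1_hasseWeil hKO hBCS hGr h5 hGV hS hPR hmodP hmodL hGZK W A hW hA hr hrA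
    (bsdp_s8092e1 hGZK A hA hrA hqA hvA hSelA) hSchA hcertA hcong

end Summit.BirchSwinnertonDyer.Rank1Residual.X9

end
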